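import Summits.CriticalPhenomena.PercolationContinuityZ3.Theorems.PercNearOneGluingNoHeavyQuantTwoPointHubSliver
import Summits.CriticalPhenomena.PercolationContinuityZ3.Theorems.PercNearOneGluingNoHeavyQuantIndepBlobTwoLevelRow
import HarnessLib

/-!
# QUANT lane R8, FAR on trees: TP1 in the sliver for ALL gates, from the single remaining blob lemma (U) at one level

builds on p205010 (kernel theorem, internal audit signed; external expert review pending)

Support file (`--supports stmt-CriticalPhenomena-4575`), QUANT lane seat prim-quant-census-1 (gen 11); memo
`run/shared/lean/prim/quant/prim-quant-census-1/B4-SLIVER-G11.md` §7–§10.  Theorems only; no sorries; standard axioms.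

`Quant.IndepBlob.twoPointHub_sliver_of_U`: in the setting of `Quant.IndepBlob.twoPointHub_sliver_of_rows` (blob sum `W` with integer sizes `a k ≥ 1`, least reliable
blob `y₀` with gate `g`; integers `1 ≤ i`, `i + 1 ≤ c`, `c + 1 ≤ y`; `d ∈ (0,1)`, `i + d < c`; `EW > 2y − 2 − d`), the two-point-hub inequality
`min((2i+d)/(i+c), g) ≤ (1 − λ)·P(y ≤ W) + λ·P(y − c ≤ W)` (`λ = (i+d)/c`) follows from the SINGLE hypothesis
   (U)  `g ≤ 1/2 → g ≤ P(y ≤ W)`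
("block-star FAR half a level up holds outright when the least gate is at most one half"; memo §8: 0 failures in 6.4·10⁵ exact instances, open as a theorem).
Proof: if `g ≥ 1/2` use the rows `twoLevelRow_of_half_le_gate` + `tail_ge_gate_of_two_mul_le_size` (this case is also `twoPointHub_sliver_of_half_le_gate` of `…TwoPointHubSliverHigh`); otherwise feed `twoPointHub_sliver_of_rows` with row (A') = (U) + block-star FAR at level
`y − 2` (`2(y−3) < EW`) and row (S) = (U).  So (B-4) of PROFILE-PROOF-G10 — hence the profile conjecture `Quant.HubBlocksProfileIneq` along census-1 gen 10's
route and census-2 gen 46's vertex step — rests on (U) alone. [this work]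
-/

namespace Summit.CriticalPhenomena.PercolationContinuityZ3.Theorems

namespace Quant

namespace IndepBlob

open Finset

variable {κ : Type*} [Fintype κ] [DecidableEq κ]

/-- **TP1-sliver from (U).**  Gates `0 ≤ p k ≤ 1` with least reliable blob `y₀`; integer sizes `a k ≥ 1`; integers `1 ≤ i`, `i + 1 ≤ c`, `c + 1 ≤ y`; a real
`0 < d < 1` with `i + d < c`; `2y − 2 − d < EW`; and the hypothesis (U) `p y₀ ≤ 1/2 → p y₀ ≤ P(y ≤ W)`.  Then
`min((2i+d)/(i+c), p y₀) ≤ (1 − (i+d)/c)·P(y ≤ W) + ((i+d)/c)·P(y − c ≤ W)`. [this work] -/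
theorem twoPointHub_sliver_of_U (p : κ → ℝ) (a : κ → ℕ) (hp0 : ∀ k, 0 ≤ p k) (hp1 : ∀ k, p k ≤ 1) (ha : ∀ k, 1 ≤ a k)
    (y₀ : κ) (hy₀ : ∀ k, p y₀ ≤ p k) (i c y : ℕ) (d : ℝ) (hi : 1 ≤ i) (hic : i + 1 ≤ c) (hcy : c + 1 ≤ y)
    (hd0 : 0 < d) (hd1 : d < 1) (hdc : (i : ℝ) + d < c)
    (hEW : 2 * (y : ℝ) - 2 - d < ∑ k, (a k : ℝ) * p k)
    (hU : p y₀ ≤ 1 / 2 → p y₀ ≤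
      ∑ s ∈ (Finset.univ : Finset (Finset κ)).filter (fun s => y ≤ ∑ k ∈ s, a k), (∏ k, if k ∈ s then p k else 1 - p k)) :
    min ((2 * (i : ℝ) + d) / ((i : ℝ) + c)) (p y₀) ≤
      (1 - ((i : ℝ) + d) / c) *
          ∑ s ∈ (Finset.univ : Finset (Finset κ)).filter (fun s => y ≤ ∑ k ∈ s, a k), (∏ k, if k ∈ s then p k else 1 - p k) +
        (((i : ℝ) + d) / c) *
          ∑ s ∈ (Finset.univ : Finset (Finset κ)).filter (fun s => y - c ≤ ∑ k ∈ s, a k), (∏ k, if k ∈ s then p k else 1 - p k) := by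
  by_cases hhalf : 1 / 2 ≤ p y₀
  · -- all gates `≥ 1/2`: rows from `twoLevelRow_of_half_le_gate` and `tail_ge_gate_of_two_mul_le_size` (as in `…TwoPointHubSliverHigh`)
    refine twoPointHub_sliver_of_rows p a hp0 hp1 y₀ i c y d hi hic hcy hd0 hd1 hdc hEW (fun _ => ?_) (fun _ hT => ?_)
    · have hy2 : y - 2 + 2 = y := by omega
      have hcast : ((y - 2 : ℕ) : ℝ) = (y : ℝ) - 2 := by
        have : 2 ≤ y := by omega
        rw [Nat.cast_sub this]
        push_cast
        ring
      have h' : 2 * ((y - 2 : ℕ) : ℝ) + 1 < ∑ k, (a k : ℝ) * p k := by rw [hcast]; linarith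
      have := twoLevelRow_of_half_le_gate p a hp0 hp1 ha y₀ hy₀ hhalf (y - 2) h'
      rw [hy2] at this
      exact this
    · exact (min_le_right _ _).trans (tail_ge_gate_of_two_mul_le_size p a hp0 hp1 y₀ hy₀ hhalf y hT)
  push Not at hhalf
  have hUy := hU hhalf.le
  have hw0 : ∀ s : Finset κ, 0 ≤ (∏ k, if k ∈ s then p k else 1 - p k) := bernoulliWeight_nonneg hp0 hp1
  refine twoPointHub_sliver_of_rows p a hp0 hp1 y₀ i c y d hi hic hcy hd0 hd1 hdc hEW (fun _ => ?_) (fun _ _ => (min_le_right _ _).trans hUy)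
  -- row (A'): `P(y ≤ W) ≥ g` by (U) and `P(y − 2 ≤ W) ≥ g` by block-star FAR at `j = y − 3`
  have hjm : 2 * ((y : ℝ) - 3) < ∑ k, (a k : ℝ) * p k := by linarith
  have hfar := far_indepBlob_min p (fun k => (a k : ℝ)) hp0 hp1 (fun k => by positivity) y₀ hy₀ ((y : ℝ) - 3) hjm
  have hcompl := Finset.sum_filter_add_sum_filter_not (Finset.univ : Finset (Finset κ))
    (fun s => y - 2 ≤ ∑ k ∈ s, a k) (fun s => (∏ k, if k ∈ s then p k else 1 - p k))
  rw [sum_bernoulliWeight p] at hcompl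
  have hsub : ∑ s ∈ (Finset.univ : Finset (Finset κ)).filter (fun s => ¬ (y - 2 ≤ ∑ k ∈ s, a k)),
      (∏ k, if k ∈ s then p k else 1 - p k) ≤
      ∑ s ∈ (Finset.univ : Finset (Finset κ)).filter (fun s => ∑ k ∈ s, (a k : ℝ) ≤ (y : ℝ) - 3),
      (∏ k, if k ∈ s then p k else 1 - p k) := by
    refine Finset.sum_le_sum_of_subset_of_nonneg (fun s hs => ?_) fun s _ _ => hw0 s
    rw [Finset.mem_filter] at hs ⊢
    refine ⟨hs.1, ?_⟩
    have hy3 : 3 ≤ y := by omega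
    have hlt : ∑ k ∈ s, a k + 3 ≤ y := by have := hs.2; omega
    have hcast : ((∑ k ∈ s, a k + 3 : ℕ) : ℝ) ≤ ((y : ℕ) : ℝ) := by exact_mod_cast hlt
    push_cast at hcast
    linarith
  have hP2 : p y₀ ≤ ∑ s ∈ (Finset.univ : Finset (Finset κ)).filter (fun s => y - 2 ≤ ∑ k ∈ s, a k),
      (∏ k, if k ∈ s then p k else 1 - p k) := by linarith
  linarith
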